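import Summits.HodgeConjecture.HodgeConjecture.Theorems.TropicalWeilObstructionTropicalHodgeBoundCertDataC

/-!
# Crux `TropicalHodgeBound` (stmt-HodgeConjecture-18480), stub 4 — part C4.6: kernel run of the
# certificate, chunks 36–42

Route `TropicalWeilObstruction` of `HodgeConjecture`, registered line `birth`, stub
`stub_rationalHodgeCoordinates`. Each theorem states that one chunk of the propagation certificate
(`…CertData*`) passes the checker `Chk.checkChunk` of `…ChkCore` (incoming boundary facts, packed steps,
outgoing boundary facts, final unknowns); proved by `decide +kernel` (pure integer/list computation,
≈ 10⁶–10⁷ kernel reductions per chunk, hence the raised `maxHeartbeats`/`maxRecDepth`). Soundness of the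
checker (`…CheckerSound`, `…CheckerEquations`) turns these into linear relations among the integer
coordinates of a tropical cycle class (`…Certificate`).

References: [Zharkov2020TropicalWeil] I. Zharkov, arXiv:2002.02347, §2; [MikhalkinZharkov2014Eigenwave]
G. Mikhalkin, I. Zharkov, LN UMI 15 (2014), Thm. 5.4.
-/

set_option linter.dupNamespace false

namespace Summit.HodgeConjecture.HodgeConjecture.Theorems.TropicalHodgeBound

namespace Chk

set_option maxRecDepth 100000 in
set_option maxHeartbeats 400000000 in
/-- Chunk `36` of the certificate passes the checker. [cite: Zharkov2020TropicalWeil, §2] -/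
theorem chunk36_ok : checkChunk [] ch36 [] (ch36.map stepTarget) = true := by
  decide +kernel

set_option maxRecDepth 100000 in
set_option maxHeartbeats 400000000 in
/-- Chunk `37` of the certificate passes the checker. [cite: Zharkov2020TropicalWeil, §2] -/
theorem chunk37_ok : checkChunk [] ch37 [] (ch37.map stepTarget) = true := by
  decide +kernel

set_option maxRecDepth 100000 in
set_option maxHeartbeats 400000000 in
/-- Chunk `38` of the certificate passes the checker. [cite: Zharkov2020TropicalWeil, §2] -/
theorem chunk38_ok : checkChunk [] ch38 [] (ch38.map stepTarget) = true := by
  decide +kernel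

set_option maxRecDepth 100000 in
set_option maxHeartbeats 400000000 in
/-- Chunk `39` of the certificate passes the checker. [cite: Zharkov2020TropicalWeil, §2] -/
theorem chunk39_ok : checkChunk [] ch39 [] (ch39.map stepTarget) = true := by
  decide +kernel

set_option maxRecDepth 100000 in
set_option maxHeartbeats 400000000 in
/-- Chunk `40` of the certificate passes the checker. [cite: Zharkov2020TropicalWeil, §2] -/
theorem chunk40_ok : checkChunk [] ch40 [] (ch40.map stepTarget) = true := by
  decide +kernel

set_option maxRecDepth 100000 in
set_option maxHeartbeats 400000000 in
/-- Chunk `41` of the certificate passes the checker. [cite: Zharkov2020TropicalWeil, §2] -/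
theorem chunk41_ok : checkChunk [] ch41 [] (ch41.map stepTarget) = true := by
  decide +kernel

set_option maxRecDepth 100000 in
set_option maxHeartbeats 400000000 in
/-- Chunk `42` of the certificate passes the checker. [cite: Zharkov2020TropicalWeil, §2] -/
theorem chunk42_ok : checkChunk [] ch42 [] (ch42.map stepTarget) = true := by
  decide +kernel

end Chk

end Summit.HodgeConjecture.HodgeConjecture.Theorems.TropicalHodgeBound
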